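import Mathlib
import Literature.NumberTheory.LFunctions.Zhang2022.TypedSection10B
import Literature.NumberTheory.LFunctions.Zhang2022.Section8cStatements
import Literature.NumberTheory.LFunctions.Zhang2022.Section10WindowAbel
import Literature.NumberTheory.LFunctions.MontgomeryOffDiagonalTools
import HarnessLib

/-!
# Zhang (2022) §10: the range-average rule `Σ_{P^a≤n<P^b}|χ(n)|λ₀ⱼ(n)φ(n)⁻¹G(n) → 𝔠_D∫G(t)dt/t`
# behind every "second line" of §10 (and §§12, 18), as a kernel tool

Topic `Literature/NumberTheory/LFunctions/Zhang2022` (Landau–Siegel audit tree; verdict-neutral).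
Y. Zhang, *Discrete mean estimates and the Landau–Siegel zero*, arXiv:2211.02515v1 (2022)
[Zhang2022LandauSiegel] — **an unrefereed manuscript under adjudication**; theorem-only TOOL file
(campaign siegel-zhang, L3 LEDGER #11: "generic range-average engine", part 2/3, no DAG node of its own).
Every range evaluation of §10 has a "second line" of the shape
`(500L′(1,χ)²/(θ log²P)) Σ_{P^a≤n<P^b} |χ(n)|λ₀ⱼ(n)φ(n)⁻¹ G(n) = (500𝔞/(θ log P))∫_a^b G₀(z)dz + o(α)`
[Z22 pp. 57–61: the displays before (10.12), (10.13), (10.14), (10.15); typed by L3-t2/t8 as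
`Typed.Sec10B.Eq1036b/1036c/1037b/1038b/1043b/1044b`, `Typed.Sec10C.…`, over `Typed.Sec10B.nAvg`],
obtained in the manuscript exactly as (8.11) is [Z22 p. 48, tex L2459–2467]: `λ₀ⱼ(n) = φ(n)²n⁻²(1 + O)`,
the mean value `Σ_{n<x}|χ(n)|φ(n)n⁻² = 𝔠_D log x + O(log 𝓛)` (`𝔠_D = (6/π²)∏_{q∣D} q/(q+1)`,
"[T, 1.2.12]"), partial summation, `x = P^z`. This file proves that passage ONCE, from the two §8
inputs taken as HYPOTHESES (typed CLAIM nodes `Section8cStatements.Step8u047 c′` = Z22:§8.u047 and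
`Section8cStatements.Step8u048` = Z22:§8.u048, L2's), for an arbitrary `C¹` profile:

* the partial summation is the window Abel lemma `RangeAverage.norm_sum_Ioc_mul_sub_integral_le`
  of part 1/3 (`Section10WindowAbel.lean`);
* `nAvg_eval` — **the rule**: under `Step8u047 c′`, `Step8u048`, for all large `D`, `j ∈ {1,2,3}`,
  `1 ≤ lo ≤ hi`, `hi + 1 < P`, and `F` differentiable on `[lo, hi]` with `‖F‖ ≤ M`, `‖F′(t)‖ ≤ M′/t`:
  `‖nAvg(lo, hi, F) − 𝔠_D∫_{lo}^{hi} F(t)dt/t‖ ≤ C·(M𝓛 + M′ log 𝓛 · log(hi/lo))`, `C = C(C₄₇, C₄₈)`.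

In the applications `M = O(1)`, `M′ = O(α)` (`α = π𝓛⁻⁹`) and `log(hi/lo) ≤ log P = 𝓛⁹`, so the
error is `O(𝓛)` against a main term of size `𝔠_D log P = O(𝓛⁹)`; the companion
`Section10RangeSecondLine.lean` performs `x = P^z` and the `𝔞 = 𝔠_D L′(1,χ)²` packaging to the
printed `(500𝔞/(θ log P))∫_a^b … dz + o(α)` shape. No hypothesis (A) is used. Verdict-neutral: the
§8 inputs stay hypotheses (Z22:§8.u047 is discharged in the tree by sz-d16; Z22:§8.u048 is a CLAIM).

## References

* Y. Zhang, arXiv:2211.02515v1 (2022), §8 (8.11) p. 48; §10 pp. 57–61.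
  [cite: Zhang2022LandauSiegel, §10 pp. 57–61]
* H. L. Montgomery, R. C. Vaughan, *Multiplicative Number Theory I*, CUP 2007, Thm. 4.2 (Abel
  summation). [cite: MontgomeryVaughan2007, Thm. 4.2]
-/

noncomputable section

open Complex Real MeasureTheory Set Finset
open Literature.NumberTheory.LFunctions.Zhang2022.Skeleton
open Literature.NumberTheory.LFunctions.Zhang2022.Typed

namespace Literature.NumberTheory.LFunctions.Zhang2022.RangeAverage

/-! ### §1. Small facts about `𝓛`, `α`, `𝔠_D` -/

/-- `D ≥ 21 ⇒ 𝓛 = log D ≥ 3` (`e³ < 20.1`; cf. `Section8Ded823.three_le_ell`). [folklore] -/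
private theorem three_le_ell {D : ℕ} (hD : 21 ≤ D) : 3 ≤ ell D := by
  rw [ell, Real.le_log_iff_exp_le (by positivity)]
  have h21 : (21 : ℝ) ≤ D := by exact_mod_cast hD
  have he := Real.exp_one_lt_d9
  have he0 := Real.exp_pos 1
  have h3 : Real.exp 3 = Real.exp 1 ^ 3 := by rw [← Real.exp_nat_mul]; norm_num
  have h4 : Real.exp 1 ^ 3 < (2.7182818286 : ℝ) ^ 3 := by gcongr
  rw [h3]; norm_num at h4; linarith

/-- `𝓛 ≥ 3 ⇒ log 𝓛 ≥ 1` (`e < 3`; `𝓛` of (2.1)). [cite: Zhang2022LandauSiegel, §2 (2.1)] -/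
theorem one_le_log_ell {D : ℕ} (hℓ : 3 ≤ ell D) : 1 ≤ Real.log (ell D) := by
  rw [Real.le_log_iff_exp_le (by linarith)]
  have he := Real.exp_one_lt_d9
  linarith

/-- `α𝓛 = π𝓛⁻⁸` (`𝓛 > 0`; cf. `Typed.Sec10C.alpha_mul_ell`). [folklore] -/
private theorem alpha_mul_ell_eq {D : ℕ} (hℓ : 0 < ell D) : alpha D * ell D = π / ell D ^ 8 := by
  rw [alpha, bigP, Real.log_exp]; field_simp

/-- `0 ≤ 𝔠_D = (6/π²)∏_{q∣D} q/(q+1) ≤ 1`. [cite: Zhang2022LandauSiegel, §2 (2.31)] -/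
theorem frakcD_bounds (D : ℕ) :
    0 ≤ 6 / π ^ 2 * ∏ q ∈ D.primeFactors, ((q : ℝ) / (q + 1)) ∧
      6 / π ^ 2 * ∏ q ∈ D.primeFactors, ((q : ℝ) / (q + 1)) ≤ 1 := by
  have hprod0 : 0 ≤ ∏ q ∈ D.primeFactors, ((q : ℝ) / (q + 1)) :=
    Finset.prod_nonneg fun q _ => by positivity
  have hprod1 : ∏ q ∈ D.primeFactors, ((q : ℝ) / (q + 1)) ≤ 1 :=
    Finset.prod_le_one (fun q _ => by positivity) fun q _ => by
      rw [div_le_one (by positivity)]; linarith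
  have hπ : 6 / π ^ 2 ≤ 1 := by
    rw [div_le_one (by positivity)]; nlinarith [Real.pi_gt_three]
  refine ⟨by positivity, ?_⟩
  calc 6 / π ^ 2 * ∏ q ∈ D.primeFactors, ((q : ℝ) / (q + 1)) ≤ 1 * 1 := by
        gcongr
    _ = 1 := one_mul 1

/-- Arithmetic of the final constant: with `a, b, M, M′, L ≥ 0` and `1 ≤ lg ≤ ℓ`,
`60aMℓ + 2M + (b·lg + 1)(2M + M′L) ≤ (60a + 3b + 5)(Mℓ + M′·lg·L)`. [folklore] -/
private theorem final_bound {a b M M' ℓ lg L : ℝ} (ha : 0 ≤ a) (hb : 0 ≤ b) (hM : 0 ≤ M) (hM' : 0 ≤ M')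
    (hL : 0 ≤ L) (hlg : 1 ≤ lg) (hlgℓ : lg ≤ ℓ) :
    60 * a * M * ℓ + 2 * M + (b * lg + 1) * (2 * M + M' * L) ≤
      (60 * a + 3 * b + 5) * (M * ℓ + M' * lg * L) := by
  have h1 : M ≤ M * ℓ := by nlinarith
  have h2 : M * lg ≤ M * ℓ := by nlinarith
  have h3 : M' * L ≤ M' * lg * L := by nlinarith [mul_nonneg hM' hL]
  have h4 : 0 ≤ M' * lg * L := by positivity
  have h5 : 0 ≤ M * ℓ := by nlinarith
  nlinarith [mul_nonneg hb (sub_nonneg.mpr h2), mul_nonneg ha h5, mul_nonneg hb h4,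
    mul_nonneg hb (sub_nonneg.mpr h1), mul_nonneg hb (sub_nonneg.mpr h3)]

/-- `7π + 12πℓ ≤ 60ℓ` for `ℓ ≥ 1` (`19π < 60`). [folklore] -/
private theorem sixty_ell {ℓ : ℝ} (hℓ : 1 ≤ ℓ) : 7 * (π / 1) + 12 * (π * ℓ) ≤ 60 * ℓ := by
  have hπ := Real.pi_lt_d2
  have hπ0 := Real.pi_pos
  nlinarith

/-! ### §2. The engine: `nAvg(lo, hi, F) = 𝔠_D ∫_{lo}^{hi} F(t)dt/t + O(M𝓛 + M′ log 𝓛 log(hi/lo))` -/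

/-- **The range-average rule** (the "second line" passage of every §10 range evaluation, derived as
the manuscript derives (8.11)): assume Z22:§8.u047 (`Section8cStatements.Step8u047 c′`:
`λ₀ⱼ(n) = φ(n)²/n² + O(α𝓛)`, `n < P`) and Z22:§8.u048 (`Section8cStatements.Step8u048`:
`Σ_{n<x}|χ(n)|φ(n)/n² = 𝔠_D log x + O(log 𝓛)`, `x < P`). Then there is `C` such that for all large `D`
(and the real primitive `χ mod D` of the frame), all `j ∈ {1,2,3}`, all windows `1 ≤ lo ≤ hi` with
`hi + 1 < P`, and every `F` differentiable on `[lo, hi]` with `‖F‖ ≤ M`, `‖F′(t)‖ ≤ M′/t` there: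
`‖Σ_{lo≤n<hi} |χ(n)|λ₀ⱼ(n)φ(n)⁻¹F(n) − 𝔠_D∫_{lo}^{hi} F(t)dt/t‖ ≤ C(M𝓛 + M′·log 𝓛·log(hi/lo))`
(the sum is `Typed.Sec10B.nAvg c′ χ j lo hi F`). [cite: Zhang2022LandauSiegel, §10 pp. 57–61; §8 (8.11) p. 48] -/
theorem nAvg_eval {c' : ℝ} (h47 : Section8cStatements.Step8u047 c')
    (h48 : Section8cStatements.Step8u048) :
    ∃ C : ℝ, 0 ≤ C ∧ ForAllLarge fun D _ χ => ∀ j ∈ ({1, 2, 3} : Finset ℕ), ∀ lo hi : ℝ,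
      1 ≤ lo → lo ≤ hi → hi + 1 < bigP D → ∀ (F : ℝ → ℂ) (M M' : ℝ), 0 ≤ M → 0 ≤ M' →
        (∀ t ∈ Set.Icc lo hi, DifferentiableAt ℝ F t) → (∀ t ∈ Set.Icc lo hi, ‖F t‖ ≤ M) →
        (∀ t ∈ Set.Icc lo hi, ‖deriv F t‖ ≤ M' / t) →
        ‖Sec10B.nAvg c' χ j lo hi (fun n => F n) -
            ((6 / π ^ 2 * ∏ q ∈ D.primeFactors, ((q : ℝ) / (q + 1)) : ℝ) : ℂ) *
              ∫ t in lo..hi, F t / t‖ ≤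
          C * (M * ell D + M' * Real.log (ell D) * Real.log (hi / lo)) := by
  obtain ⟨C₄₇, D₁, h47⟩ := h47
  obtain ⟨C₄₈, D₂, h48⟩ := h48
  refine ⟨60 * |C₄₇| + 3 * |C₄₈| + 5, by positivity, max D₁ (max D₂ 21),
    fun D _ χ hD hq hp j hj lo hi hlo hlohi hhiP F M M' hM hM' hFd hF hF' => ?_⟩
  have hD₁ : D₁ ≤ D := le_trans (le_max_left _ _) hD
  have hD₂ : D₂ ≤ D := le_trans (le_max_left _ _) (le_trans (le_max_right _ _) hD)
  have hD21 : 21 ≤ D := le_trans (le_max_right _ _) (le_trans (le_max_right _ _) hD)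
  have hℓ3 : 3 ≤ ell D := three_le_ell hD21
  have hℓ0 : 0 < ell D := by linarith
  have hℓ1 : 1 ≤ ell D := by linarith
  have hlogℓ : 1 ≤ Real.log (ell D) := one_le_log_ell hℓ3
  have hlogℓ' : Real.log (ell D) ≤ ell D := (Real.log_le_sub_one_of_pos hℓ0).trans (by linarith)
  have hαℓ : alpha D * ell D = π / ell D ^ 8 := alpha_mul_ell_eq hℓ0
  have hαℓ0 : 0 ≤ alpha D * ell D := by rw [hαℓ]; positivity
  have hαℓ1 : alpha D * ell D * ell D ^ 9 = π * ell D := by rw [hαℓ]; field_simp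
  have hlo0 : 0 < lo := by linarith
  have hhi0 : 0 < hi := by linarith
  have hP : 0 < bigP D := Real.exp_pos _
  have hlogP : Real.log (bigP D) = ell D ^ 9 := by rw [bigP, Real.log_exp]
  -- names
  set 𝔠 : ℝ := 6 / π ^ 2 * ∏ q ∈ D.primeFactors, ((q : ℝ) / (q + 1)) with h𝔠
  have h𝔠01 := frakcD_bounds D
  set w : ℕ → ℂ := fun n => (‖χ (n : ZMod D)‖ : ℂ) * lamZero c' D j n / (Nat.totient n : ℂ) with hw
  set w₀ : ℕ → ℝ := fun n => ‖χ (n : ZMod D)‖ * (Nat.totient n : ℝ) / (n : ℝ) ^ 2 with hw₀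
  set W : Finset ℕ := (Finset.Ico 1 ⌈hi⌉₊).filter (fun n : ℕ => lo ≤ (n : ℝ)) with hW
  set A : Finset ℕ := Finset.Ioc ⌊lo⌋₊ ⌊hi⌋₊ with hA
  have hnAvg : Sec10B.nAvg c' χ j lo hi (fun n => F n) = ∑ n ∈ W, w n * F n := rfl
  -- membership facts
  have hmemW : ∀ n ∈ W, 1 ≤ n ∧ (n : ℝ) < hi ∧ lo ≤ (n : ℝ) := by
    intro n hn
    rw [hW, Finset.mem_filter, Finset.mem_Ico] at hn
    exact ⟨hn.1.1, Nat.lt_ceil.mp hn.1.2, hn.2⟩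
  have hmemA : ∀ n ∈ A, lo < (n : ℝ) ∧ (n : ℝ) ≤ hi := by
    intro n hn
    rw [hA, Finset.mem_Ioc] at hn
    exact ⟨Nat.lt_of_floor_lt hn.1, (Nat.le_floor_iff hhi0.le).mp hn.2⟩
  -- `w₀(n) ≤ 1` and `w₀(0) = 0`
  have hw₀le : ∀ n : ℕ, |w₀ n| ≤ 1 := by
    intro n
    rcases Nat.eq_zero_or_pos n with rfl | hn
    · simp [hw₀]
    have hn0 : (0 : ℝ) < n := by exact_mod_cast hn
    have hχ1 : ‖χ (n : ZMod D)‖ ≤ 1 := χ.norm_le_one _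
    have hφ : (Nat.totient n : ℝ) ≤ n := by exact_mod_cast Nat.totient_le n
    have hw₀n : 0 ≤ w₀ n := by simp only [hw₀]; positivity
    rw [abs_of_nonneg hw₀n]
    simp only [hw₀]
    rw [div_le_one (by positivity)]
    calc ‖χ (n : ZMod D)‖ * (Nat.totient n : ℝ) ≤ 1 * n := by gcongr
      _ = (n : ℝ) ^ 1 := by ring
      _ ≤ (n : ℝ) ^ 2 := pow_le_pow_right₀ (by exact_mod_cast hn) (by norm_num)
  have hw₀0 : w₀ 0 = 0 := by simp [hw₀]
  -- (1) replace `λ₀ⱼ/φ` by `φ/n²`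
  have hterm : ∀ n ∈ W, ‖w n * F n - (w₀ n : ℂ) * F n‖ ≤
      |C₄₇| * (alpha D * ell D) * M * (1 / (Nat.totient n : ℝ)) := by
    intro n hn
    obtain ⟨hn1, hnhi, hnlo⟩ := hmemW n hn
    have hnP : (n : ℝ) < bigP D := by linarith
    have hφpos : 0 < Nat.totient n := Nat.totient_pos.mpr hn1
    have hφ0 : (Nat.totient n : ℂ) ≠ 0 := by exact_mod_cast hφpos.ne'
    have hn0 : (n : ℂ) ≠ 0 := by exact_mod_cast (show n ≠ 0 by omega)
    have hlam := h47 D χ hD₁ hq hp j hj n hn1 hnP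
    have e : w n * F n - (w₀ n : ℂ) * F n = (‖χ (n : ZMod D)‖ : ℂ) *
        (lamZero c' D j n - ((Nat.totient n : ℂ) / (n : ℂ)) ^ 2) / (Nat.totient n : ℂ) * F n := by
      simp only [hw, hw₀]; push_cast; field_simp
    rw [e, norm_mul, norm_div, norm_mul, Complex.norm_real, Complex.norm_natCast, Real.norm_eq_abs,
      abs_of_nonneg (norm_nonneg _)]
    have hφr : (0 : ℝ) < Nat.totient n := by exact_mod_cast hφpos
    calc ‖χ (n : ZMod D)‖ * ‖lamZero c' D j n - ((Nat.totient n : ℂ) / (n : ℂ)) ^ 2‖ /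
          (Nat.totient n : ℝ) * ‖F n‖
        ≤ 1 * (|C₄₇| * (alpha D * ell D)) / (Nat.totient n : ℝ) * M := by
          gcongr
          · exact χ.norm_le_one _
          · exact hlam.trans (mul_le_mul_of_nonneg_right (le_abs_self _) hαℓ0)
          · exact hF n ⟨hnlo, hnhi.le⟩
      _ = |C₄₇| * (alpha D * ell D) * M * (1 / (Nat.totient n : ℝ)) := by ring
  have hE1 : ‖(∑ n ∈ W, w n * F n) - ∑ n ∈ W, (w₀ n : ℂ) * F n‖ ≤ 60 * |C₄₇| * M * ell D := by
    rw [← Finset.sum_sub_distrib]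
    have hsub : W ⊆ Finset.Icc 1 ⌈hi⌉₊ := by
      intro n hn; rw [hW, Finset.mem_filter] at hn
      exact Finset.mem_Icc.mpr ⟨(Finset.mem_Ico.mp hn.1).1, (Finset.mem_Ico.mp hn.1).2.le⟩
    have hφsum : ∑ n ∈ W, 1 / (Nat.totient n : ℝ) ≤ 7 + 12 * Real.log ⌈hi⌉₊ :=
      (Finset.sum_le_sum_of_subset_of_nonneg hsub fun n _ _ => by positivity).trans
        (Montgomery.sum_Icc_inv_totient_le ⌈hi⌉₊)
    have hceil : Real.log ⌈hi⌉₊ ≤ ell D ^ 9 := by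
      have h1 : (⌈hi⌉₊ : ℝ) < hi + 1 := Nat.ceil_lt_add_one hhi0.le
      have h2 : (0 : ℝ) < ⌈hi⌉₊ := by exact_mod_cast Nat.ceil_pos.mpr hhi0
      rw [← hlogP]
      exact Real.log_le_log h2 (by linarith)
    calc ‖∑ n ∈ W, (w n * F n - (w₀ n : ℂ) * F n)‖
        ≤ ∑ n ∈ W, ‖w n * F n - (w₀ n : ℂ) * F n‖ := norm_sum_le _ _
      _ ≤ ∑ n ∈ W, |C₄₇| * (alpha D * ell D) * M * (1 / (Nat.totient n : ℝ)) :=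
          Finset.sum_le_sum hterm
      _ = |C₄₇| * (alpha D * ell D) * M * ∑ n ∈ W, 1 / (Nat.totient n : ℝ) := by
          rw [Finset.mul_sum]
      _ ≤ |C₄₇| * (alpha D * ell D) * M * (7 + 12 * ell D ^ 9) := by
          gcongr; linarith
      _ = |C₄₇| * M * (7 * (alpha D * ell D) + 12 * (alpha D * ell D * ell D ^ 9)) := by ring
      _ ≤ |C₄₇| * M * (7 * (π / 1) + 12 * (π * ell D)) := by
          rw [hαℓ1, hαℓ]
          gcongr
          exact one_le_pow₀ hℓ1
      _ ≤ |C₄₇| * M * (60 * ell D) :=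
          mul_le_mul_of_nonneg_left (sixty_ell hℓ1) (by positivity)
      _ = 60 * |C₄₇| * M * ell D := by ring
  -- (2) the index sets `W` (typed) and `A` (Abel) differ by at most the two endpoints
  have hWA : W \ A ⊆ {⌊lo⌋₊} := by
    intro n hn
    rw [Finset.mem_sdiff] at hn
    obtain ⟨hn1, hnhi, hnlo⟩ := hmemW n hn.1
    rw [Finset.mem_singleton]
    have hnfl : n ≤ ⌊hi⌋₊ := Nat.le_floor hnhi.le
    have : ¬ ⌊lo⌋₊ < n := fun h => hn.2 (Finset.mem_Ioc.mpr ⟨h, hnfl⟩)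
    have h2 : ⌊lo⌋₊ ≤ n := Nat.floor_le_of_le hnlo
    omega
  have hAW : A \ W ⊆ {⌊hi⌋₊} := by
    intro n hn
    rw [Finset.mem_sdiff] at hn
    obtain ⟨hnlo, hnhi⟩ := hmemA n hn.1
    rw [Finset.mem_singleton]
    have hn1 : 1 ≤ n := by
      have : (0 : ℝ) < n := by linarith
      exact_mod_cast this
    have : ¬ (n : ℝ) < hi := fun h =>
      hn.2 (by rw [hW, Finset.mem_filter, Finset.mem_Ico]; exact ⟨⟨hn1, Nat.lt_ceil.mpr h⟩, hnlo.le⟩)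
    have heq : (n : ℝ) = hi := le_antisymm hnhi (not_lt.mp this)
    rw [← heq, Nat.floor_natCast]
  have hE3 : ‖(∑ n ∈ W, (w₀ n : ℂ) * F n) - ∑ n ∈ A, F n * (w₀ n : ℂ)‖ ≤ 2 * M := by
    have eA' : ∑ n ∈ A, F n * (w₀ n : ℂ) = ∑ n ∈ A, (w₀ n : ℂ) * F n :=
      Finset.sum_congr rfl fun n _ => mul_comm _ _
    rw [eA', ← Finset.sum_sdiff_sub_sum_sdiff]
    have hbd : ∀ n : ℕ, lo ≤ n → (n : ℝ) ≤ hi → ‖(w₀ n : ℂ) * F n‖ ≤ M := by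
      intro n h1 h2
      rw [norm_mul, Complex.norm_real, Real.norm_eq_abs]
      calc |w₀ n| * ‖F n‖ ≤ 1 * M := by gcongr; exacts [hw₀le n, hF n ⟨h1, h2⟩]
        _ = M := one_mul M
    have h1 : ‖∑ n ∈ W \ A, (w₀ n : ℂ) * F n‖ ≤ M := by
      refine (norm_sum_le _ _).trans ?_
      calc ∑ n ∈ W \ A, ‖(w₀ n : ℂ) * F n‖ ≤ ∑ n ∈ ({⌊lo⌋₊} : Finset ℕ), M := by
            refine le_trans (Finset.sum_le_sum fun n hn => ?_)
              (Finset.sum_le_sum_of_subset_of_nonneg hWA fun _ _ _ => hM)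
            obtain ⟨-, hnhi, hnlo⟩ := hmemW n (Finset.mem_sdiff.mp hn).1
            exact hbd n hnlo hnhi.le
        _ = M := by simp
    have h2 : ‖∑ n ∈ A \ W, (w₀ n : ℂ) * F n‖ ≤ M := by
      refine (norm_sum_le _ _).trans ?_
      calc ∑ n ∈ A \ W, ‖(w₀ n : ℂ) * F n‖ ≤ ∑ n ∈ ({⌊hi⌋₊} : Finset ℕ), M := by
            refine le_trans (Finset.sum_le_sum fun n hn => ?_)
              (Finset.sum_le_sum_of_subset_of_nonneg hAW fun _ _ _ => hM)
            obtain ⟨hnlo, hnhi⟩ := hmemA n (Finset.mem_sdiff.mp hn).1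
            exact hbd n hnlo.le hnhi
        _ = M := by simp
    calc _ ≤ ‖∑ n ∈ W \ A, (w₀ n : ℂ) * F n‖ + ‖∑ n ∈ A \ W, (w₀ n : ℂ) * F n‖ := norm_sub_le _ _
      _ ≤ M + M := add_le_add h1 h2
      _ = 2 * M := by ring
  -- (3) the counting function of `w₀` on `[lo, hi]`
  have hcount : ∀ t ∈ Set.Icc lo hi,
      |(∑ k ∈ Finset.Icc 0 ⌊t⌋₊, w₀ k) - 𝔠 * Real.log t| ≤ |C₄₈| * Real.log (ell D) + 1 := by
    intro t ht
    have ht1 : 1 ≤ t := hlo.trans ht.1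
    have ht0 : 0 < t := by linarith
    set m : ℕ := ⌊t⌋₊ with hm
    have hx1 : (1 : ℝ) ≤ ((m + 1 : ℕ) : ℝ) := by exact_mod_cast Nat.le_add_left 1 m
    have hxP : ((m + 1 : ℕ) : ℝ) < bigP D := by
      have : (m : ℝ) ≤ t := Nat.floor_le ht0.le
      push_cast; linarith [ht.2]
    have h := h48 D χ hD₂ hq hp ((m + 1 : ℕ) : ℝ) hx1 hxP
    rw [Nat.ceil_natCast] at h
    have eS : (∑ k ∈ Finset.Icc 0 m, w₀ k) =
        ∑ n ∈ Finset.Ico 1 (m + 1), ‖χ (n : ZMod D)‖ * (Nat.totient n : ℝ) / (n : ℝ) ^ 2 := by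
      rw [Finset.Icc_eq_cons_Ioc (Nat.zero_le m), Finset.sum_cons, hw₀0, zero_add,
        Finset.Ico_add_one_right_eq_Icc, ← Finset.Icc_add_one_left_eq_Ioc]
      simp only [zero_add, hw₀]
    have hlog2 : |Real.log ((m + 1 : ℕ) : ℝ) - Real.log t| ≤ 1 := by
      have hmt : (m : ℝ) ≤ t := Nat.floor_le ht0.le
      have htm : t < (m : ℝ) + 1 := Nat.lt_floor_add_one t
      have hx0 : (0 : ℝ) < ((m + 1 : ℕ) : ℝ) := by positivity
      rw [← Real.log_div hx0.ne' ht0.ne', abs_le]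
      constructor
      · have : (1 : ℝ) ≤ ((m + 1 : ℕ) : ℝ) / t := by
          rw [le_div_iff₀ ht0]; push_cast; linarith
        linarith [Real.log_nonneg this]
      · have h2 : ((m + 1 : ℕ) : ℝ) / t ≤ 2 := by
          rw [div_le_iff₀ ht0]; push_cast; linarith
        calc Real.log (((m + 1 : ℕ) : ℝ) / t) ≤ Real.log 2 :=
              Real.log_le_log (by positivity) h2
          _ ≤ 1 := by
              have := Real.log_two_lt_d9; linarith
    calc |(∑ k ∈ Finset.Icc 0 m, w₀ k) - 𝔠 * Real.log t|
        = |((∑ k ∈ Finset.Icc 0 m, w₀ k) - 𝔠 * Real.log ((m + 1 : ℕ) : ℝ)) +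
            𝔠 * (Real.log ((m + 1 : ℕ) : ℝ) - Real.log t)| := by ring_nf
      _ ≤ |(∑ k ∈ Finset.Icc 0 m, w₀ k) - 𝔠 * Real.log ((m + 1 : ℕ) : ℝ)| +
            |𝔠 * (Real.log ((m + 1 : ℕ) : ℝ) - Real.log t)| := abs_add_le _ _
      _ ≤ C₄₈ * Real.log (ell D) + 𝔠 * 1 := by
          rw [eS, abs_mul, abs_of_nonneg h𝔠01.1]
          exact add_le_add h (mul_le_mul_of_nonneg_left hlog2 h𝔠01.1)
      _ ≤ |C₄₈| * Real.log (ell D) + 1 := by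
          have h1 : C₄₈ * Real.log (ell D) ≤ |C₄₈| * Real.log (ell D) :=
            mul_le_mul_of_nonneg_right (le_abs_self C₄₈) (by linarith)
          linarith [h𝔠01.2]
  -- (4) Abel on the window
  have hK0 : 0 ≤ |C₄₈| * Real.log (ell D) + 1 := by positivity
  have habel := norm_sum_Ioc_mul_sub_integral_le (b := w₀) (F := F) (c := 𝔠) hlo hlohi hM'
    hcount hFd hF hF'
  -- (5) assemble
  have hloghl : 0 ≤ Real.log (hi / lo) := Real.log_nonneg ((one_le_div hlo0).mpr hlohi)
  have etot : Sec10B.nAvg c' χ j lo hi (fun n => F n) - (𝔠 : ℂ) * ∫ t in lo..hi, F t / t =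
      ((∑ n ∈ W, w n * F n) - ∑ n ∈ W, (w₀ n : ℂ) * F n) +
        ((∑ n ∈ W, (w₀ n : ℂ) * F n) - ∑ n ∈ A, F n * (w₀ n : ℂ)) +
        ((∑ n ∈ A, F n * (w₀ n : ℂ)) - (𝔠 : ℂ) * ∫ t in lo..hi, F t / t) := by
    rw [hnAvg]; ring
  rw [etot]
  calc _ ≤ ‖(∑ n ∈ W, w n * F n) - ∑ n ∈ W, (w₀ n : ℂ) * F n‖ +
        ‖(∑ n ∈ W, (w₀ n : ℂ) * F n) - ∑ n ∈ A, F n * (w₀ n : ℂ)‖ +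
        ‖(∑ n ∈ A, F n * (w₀ n : ℂ)) - (𝔠 : ℂ) * ∫ t in lo..hi, F t / t‖ :=
        norm_add₃_le
    _ ≤ 60 * |C₄₇| * M * ell D + 2 * M +
        (|C₄₈| * Real.log (ell D) + 1) * (2 * M + M' * Real.log (hi / lo)) :=
        add_le_add (add_le_add hE1 hE3) habel
    _ ≤ (60 * |C₄₇| + 3 * |C₄₈| + 5) * (M * ell D + M' * Real.log (ell D) * Real.log (hi / lo)) :=
        final_bound (abs_nonneg C₄₇) (abs_nonneg C₄₈) hM hM' hloghl hlogℓ hlogℓ'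


end Literature.NumberTheory.LFunctions.Zhang2022.RangeAverage
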